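import Literature.AlgebraicGeometry.HodgeTheory.HypersurfaceComplexPoints
import Mathlib.AlgebraicGeometry.Morphisms.ClosedImmersion
import HarnessLib

/-!
# `L`-points do not see nilpotents: `X_red(L) = X(L)`, homeomorphically

Topic `Literature/AlgebraicGeometry/Motives` (point-set API of `AlgPoints`, the `L`-points of a
`k`-scheme with the strong topology); theorems only. For a `k`-morphism `i : X ⟶ Y` whose
underlying morphism of schemes is a SURJECTIVE CLOSED IMMERSION («immersion fermée bijective»:
`Y_red ↪ Y`, any nilpotent thickening):

* `exists_comp_eq_of_isClosedImmersion_of_surjective` (schemes, any universe): every morphism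
  from a REDUCED scheme into `Y` factors uniquely through `i` — the kernel ideal sheaf of `i` has
  full support (Mathlib `Scheme.Hom.support_ker`), so lies in the nilradical of `Y`, which dies in
  a reduced source; conclude by the universal property of closed immersions
  (Mathlib `IsClosedImmersion.lift`);
* `AlgPoints.map_bijective_of_isClosedImmersion_of_surjective`: `X(L) → Y(L)` is bijective
  (`Spec L` is reduced);
* `AlgPoints.isHomeomorph_map_of_isClosedImmersion_of_surjective`: it is a HOMEOMORPHISM for the
  strong topologies (a closed immersion induces an embedding,
  `AlgPoints.isEmbedding_map_of_isClosedImmersion`).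

This is the remark «`X^an` et `X_red^an` ont même espace topologique sous-jacent» behind the
reduction «on peut supposer `X` réduit … le foncteur `Θ` qui, à un revêtement étale fini de `X^an`
associe son image inverse sur `X_red^an` … est pleinement fidèle» in the proof of Riemann's
existence theorem (SGA 1 XII Thm. 5.1, part 2 a)), on the tree's carriers `Motives.ComplexPoints`;
companion of `FundamentalGroup/EtaleExtensionOfLiftings` (SGA 1 I 5.5: the algebraic side of the
same reduction) and attached to the named fact `FundamentalGroup.riemannExistence_finiteCovering`.

## References

* [SGA1] A. Grothendieck, M. Raynaud, *SGA 1* (LNM 224 / arXiv:math/0206203), Exp. XII Thm. 1.1 a)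
  (closed subschemes, p. 313) and Thm. 5.1, proof, part 2 a) (p. 333–334; p0184 of the materialised
  text); Exp. I Thm. 5.5.
* R. Hartshorne, *Algebraic Geometry*, II Ex. 2.3 (reduced scheme), Ex. 4.2.
-/

noncomputable section

open CategoryTheory AlgebraicGeometry
open _root_.Topology

namespace Literature.AlgebraicGeometry.Motives

universe u

/-- **Reduced schemes do not see nilpotents**: a morphism from a REDUCED scheme into `Y` factors
(uniquely) through any surjective closed immersion `i : X ⟶ Y` (e.g. `Y_red ↪ Y`): the kernel
ideal of `i` has full support, hence lies in the nilradical of `Y` (`Scheme.Hom.support_ker`),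
which dies in the reduced `Z` (universal property of closed immersions,
`IsClosedImmersion.lift`).
[cite: SGA1, Exp. I Thm. 5.5 (the case of a closed immersion `X ⟶ Y`)] -/
theorem exists_comp_eq_of_isClosedImmersion_of_surjective {X Y Z : Scheme.{u}} (i : X ⟶ Y)
    [IsClosedImmersion i] [Surjective i] [IsReduced Z] (g : Z ⟶ Y) :
    ∃ g₀ : Z ⟶ X, g₀ ≫ i = g := by
  refine ⟨IsClosedImmersion.lift i g ?_, IsClosedImmersion.lift_fac _ _ _⟩
  have h1 : i.ker ≤ Y.nilradical := by
    rw [← Scheme.IdealSheafData.vanishingIdeal_top,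
      ← Scheme.IdealSheafData.le_support_iff_le_vanishingIdeal]
    intro x _
    have : x ∈ (i.ker.support : Set Y) := by
      rw [Scheme.Hom.support_ker, i.surjective.range_eq, closure_univ]
      trivial
    exact this
  have h2 : Y.nilradical ≤ g.ker := by
    rw [Scheme.Hom.ker, Scheme.IdealSheafData.le_ofIdeals_iff]
    intro U s hs
    have hs' : IsNilpotent s := by
      simp only [Scheme.nilradical, Scheme.IdealSheafData.radical_ideal,
        Scheme.IdealSheafData.ideal_bot] at hs
      exact hs
    rw [RingHom.mem_ker]
    exact (hs'.map (g.app U).hom).eq_zero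
  exact h1.trans h2

/-- Uniqueness in `exists_comp_eq_of_isClosedImmersion_of_surjective` (closed immersions are
monomorphisms). [folklore] -/
theorem existsUnique_comp_eq_of_isClosedImmersion_of_surjective {X Y Z : Scheme.{u}} (i : X ⟶ Y)
    [IsClosedImmersion i] [Surjective i] [IsReduced Z] (g : Z ⟶ Y) :
    ∃! g₀ : Z ⟶ X, g₀ ≫ i = g := by
  obtain ⟨g₀, hg₀⟩ := exists_comp_eq_of_isClosedImmersion_of_surjective i g
  exact ⟨g₀, hg₀, fun g₁ hg₁ ↦ (cancel_mono i).mp (hg₁.trans hg₀.symm)⟩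

namespace AlgPoints

variable {k : Type u} [Field k] {X Y : SchemeOver k} {L : Type u} [Field L] [Algebra k L]

/-- **`L`-points do not see nilpotents**: for a `k`-morphism `i : X ⟶ Y` whose underlying
morphism is a SURJECTIVE CLOSED IMMERSION (e.g. `Y_red ↪ Y`, a nilpotent thickening), the map
`X(L) → Y(L)` of `L`-points is bijective (`Spec L` is reduced). This is «`X^an` et `X_red^an` ont
même espace sous-jacent» (SGA 1 XII 5.1, proof, part 2 a); XII 1.1 a)) on the tree's carriers.
[cite: SGA1, Exp. XII Thm. 5.1 (proof, part 2 a)) and Thm. 1.1 a)] -/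
theorem map_bijective_of_isClosedImmersion_of_surjective (i : X ⟶ Y) [IsClosedImmersion i.left]
    [Surjective i.left] : Function.Bijective (map i : AlgPoints X L → AlgPoints Y L) := by
  refine ⟨map_injective i, fun Q ↦ ?_⟩
  haveI : IsReduced (specOver k L).left :=
    inferInstanceAs (IsReduced (Spec (CommRingCat.of L)))
  obtain ⟨q₀, hq₀⟩ := exists_comp_eq_of_isClosedImmersion_of_surjective i.left Q.left
  refine ⟨Over.homMk q₀ ?_, ?_⟩
  · rw [← Over.w i, ← Category.assoc, hq₀]
    exact Over.w Q
  · ext : 1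
    exact hq₀

end AlgPoints

namespace AlgPoints

variable {k : Type} [Field k] {X Y : SchemeOver k} {L : Type} [Field L] [Algebra k L]
  [TopologicalSpace L]

/-- For `i : X ⟶ Y` over `k` with `i` a surjective closed immersion, `X(L) → Y(L)` is a
HOMEOMORPHISM for the strong topologies (a bijective embedding,
`isEmbedding_map_of_isClosedImmersion`).
[cite: SGA1, Exp. XII Thm. 5.1 (proof, part 2 a)) and Thm. 1.1 a)] -/
theorem isHomeomorph_map_of_isClosedImmersion_of_surjective (i : X ⟶ Y) [IsClosedImmersion i.left]
    [Surjective i.left] : IsHomeomorph (map i : AlgPoints X L → AlgPoints Y L) :=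
  (isHomeomorph_iff_isEmbedding_surjective).mpr ⟨isEmbedding_map_of_isClosedImmersion i,
    (map_bijective_of_isClosedImmersion_of_surjective i).2⟩

end AlgPoints

end Literature.AlgebraicGeometry.Motives

end
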